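import Summits.ValiantsHypothesis.ValiantsHypothesis.Theorems.BarrierLeverAnchoredDoorHitsLowerPairsStarPivot
import Literature.AlgebraicGeometry.DeterminantalHypersurfaces.HermitianPencilLinearity

/-!
# Route BarrierLever — support item `AnchoredDoorHitsLowerPairs` (stmt-ValiantsHypothesis-22510), line `anchored_peeling`:
# THE FACE PIVOT FOR THE STAR-FOREST MATRIX (val-np-p1 g32)

A CLOSURE RULE for the door slot of record `Stmt.conjStarLower` (…StarDoor) at the level of the star-forest matrix, generalising the
balanced VERTEX pivot `StarDoor.starDet_ne_zero_of_pivot` of …StarPivot (val-np-p1 g31) from a column VERTEX `e₀` to an arbitrary column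
FACE `T`, and dropping every lower-set hypothesis.

THE RULE (`starDet_ne_zero_of_facePivot`). Families `u w : Fin r → Finset (Fin h)` (no injectivity, no lower-set hypothesis), a row vertex
`b₀`, a set `T` of column vertices and a permutation `σ` of `Fin r` with `T ⊆ w (σ j) ↔ b₀ ∈ u j` (BALANCE: as many columns contain `T` as
rows contain `b₀`). If the LINK pair `((u i) − b₀, (w (σ j)) ∖ T)` over the indices with `b₀ ∈ u ·` and the DELETION pair `(u i, w (σ j))` over
the indices with `b₀ ∉ u ·` both have a nonsingular star-forest block for some weights, then so does `(u, w)`.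

MECHANISM. At a common good point `(g, d)` of the two blocks (…StarPivot `exists_common_point`) put `b₀`'s weights on the polynomial line
`g b₀ · = 0`, `d b₀ e = X · [e ∈ T]`: `b₀` is never a leaf and its leaves lie in `T`. A row through `b₀` then has entries of degree `≤ |T|` in
`X` whose `X^{|T|}`-coefficient is `[T ⊆ S] · starEntry g d (A − b₀) (S ∖ T)` (`coeff_starEntry_faceRow`: the top power forces `b₀` to be a
centre with leaf set exactly `T`); rows avoiding `b₀` are constant. Scaling the constant rows by `X^{|T|}`, the `X^{r|T|}`-coefficient of the
determinant is the determinant of the top coefficients (Literature `coeff_det_of_natDegree_le`), which after permuting the columns by `σ` is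
block triangular (`Matrix.twoBlockTriangular_det'`) with the link and deletion blocks on the diagonal. So the determinant is a nonzero
polynomial in `X` and some complex value of `X` is good.

USE. With `T = {e₀}` this is the vertex pivot without its lower-set hypotheses; for the census of record it halves the class of STAR-RIGID
lower pairs (no balanced vertex–vertex pivot: 164 of the 1 798 ordered pairs on `5+5` vertices; no balanced vertex–face pivot on either side:
80 of 1 798 — lab/rigid2.py of HOME/val-np-p1/g32). It does NOT prove `Stmt.conjStarLower`. Nothing here bears on crux 14610 or on `VP ≠ VNP`.
-/

set_option linter.dupNamespace false

namespace Summit.ValiantsHypothesis.ValiantsHypothesis.Theorems.BarrierLever.AnchoredPeeling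

open Finset Polynomial

noncomputable section

namespace StarDoor

variable {h : ℕ}

/-! ## 1. The polynomial line of the face pivot -/

/-! The face-pivot LINE through a point `(g, d)`: the row weights `fun b e => if b = b₀ then 0 else C (g b e)` (`b₀` is never a
leaf) and the column-leaf weights `fun b e => if b = b₀ then (if e ∈ T then X else 0) else C (d b e)` (the leaves of `b₀` lie in `T` and
carry the variable `X`); every other weight is constant. -/

/-- A row avoiding `b₀` is constant on the line. -/
theorem starEntry_fp_of_notMem (g d : Fin h → Fin h → ℂ) (b₀ : Fin h) (T : Finset (Fin h)) {A : Finset (Fin h)}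
    (hA : b₀ ∉ A) (S : Finset (Fin h)) :
    starEntry (fun b e => if b = b₀ then (0 : ℂ[X]) else C (g b e)) (fun b e => if b = b₀ then (if e ∈ T then (X : ℂ[X]) else 0) else C (d b e)) A S = C (starEntry g d A S) := by
  rw [map_starEntry]
  apply starEntry_congr
  · intro b hb e _
    have hb' : b ≠ b₀ := by rintro rfl; exact hA hb
    simp [hb']
  · intro b hb e _
    have hb' : b ≠ b₀ := by rintro rfl; exact hA hb
    simp [hb']

/-- The one-vertex factor of the line: `∏_{e ∈ R} (X·[e ∈ T] + c e)` has degree `≤ |T|` … -/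
theorem natDegree_prod_line_le (T R : Finset (Fin h)) (c : Fin h → ℂ) :
    (∏ e ∈ R, ((if e ∈ T then (X : ℂ[X]) else 0) + C (c e))).natDegree ≤ T.card := by
  classical
  calc (∏ e ∈ R, ((if e ∈ T then (X : ℂ[X]) else 0) + C (c e))).natDegree
      ≤ ∑ e ∈ R, ((if e ∈ T then (X : ℂ[X]) else 0) + C (c e)).natDegree := natDegree_prod_le _ _
    _ ≤ ∑ e ∈ R, (if e ∈ T then 1 else 0) := by
        refine Finset.sum_le_sum fun e _ => ?_
        by_cases he : e ∈ T
        · rw [if_pos he, if_pos he]; exact (natDegree_X_add_C (c e)).le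
        · rw [if_neg he, if_neg he, zero_add, natDegree_C]
    _ = (R.filter (· ∈ T)).card := by rw [Finset.card_filter]
    _ ≤ T.card := Finset.card_le_card fun e he => (Finset.mem_filter.mp he).2

/-- … and its `X^{|T|}`-coefficient is `[T ⊆ R] · ∏_{e ∈ R ∖ T} c e`. -/
theorem coeff_prod_line (T R : Finset (Fin h)) (c : Fin h → ℂ) :
    (∏ e ∈ R, ((if e ∈ T then (X : ℂ[X]) else 0) + C (c e))).coeff T.card =
      if T ⊆ R then ∏ e ∈ R \ T, c e else 0 := by
  classical
  -- split the product into the `T`-part (monic of degree `|R ∩ T|`) and the constant part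
  have hsplit : (∏ e ∈ R, ((if e ∈ T then (X : ℂ[X]) else 0) + C (c e))) =
      (∏ e ∈ R.filter (· ∈ T), (X + C (c e))) * C (∏ e ∈ R \ T, c e) := by
    rw [← Finset.prod_filter_mul_prod_filter_not R (· ∈ T)]
    congr 1
    · exact Finset.prod_congr rfl fun e he => by rw [if_pos (Finset.mem_filter.mp he).2]
    · rw [map_prod]
      have : R.filter (fun e => ¬ e ∈ T) = R \ T := by ext e; simp [Finset.mem_sdiff]
      rw [this]
      exact Finset.prod_congr rfl fun e he => by rw [if_neg (Finset.mem_sdiff.mp he).2, zero_add]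
  have hmonic : (∏ e ∈ R.filter (· ∈ T), (X + C (c e) : ℂ[X])).Monic :=
    monic_prod_of_monic _ _ fun e _ => monic_X_add_C (c e)
  have hdeg : (∏ e ∈ R.filter (· ∈ T), (X + C (c e) : ℂ[X])).natDegree = (R.filter (· ∈ T)).card := by
    rw [natDegree_prod_of_monic _ _ fun e _ => monic_X_add_C (c e)]
    simp only [natDegree_X_add_C, Finset.sum_const, smul_eq_mul, mul_one]
  rw [hsplit, coeff_mul_C]
  by_cases hTR : T ⊆ R
  · have hfilt : R.filter (· ∈ T) = T := by
      ext e; simp only [Finset.mem_filter]; exact ⟨fun h' => h'.2, fun h' => ⟨hTR h', h'⟩⟩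
    rw [hfilt] at hmonic hdeg
    rw [if_pos hTR, hfilt, ← hdeg, hmonic.coeff_natDegree, one_mul]
  · rw [if_neg hTR]
    have hlt : (∏ e ∈ R.filter (· ∈ T), (X + C (c e) : ℂ[X])).natDegree < T.card := by
      rw [hdeg]
      apply Finset.card_lt_card
      refine ⟨fun e he => (Finset.mem_filter.mp he).2, fun hsub => hTR fun e he => ?_⟩
      exact (Finset.mem_filter.mp (hsub he)).1
    rw [coeff_eq_zero_of_natDegree_lt hlt, zero_mul]

/-- **A row through `b₀` on the line: degree `≤ |T|`.** -/
theorem natDegree_starEntry_faceRow_le (g d : Fin h → Fin h → ℂ) (b₀ : Fin h) (T : Finset (Fin h)) {A₀ : Finset (Fin h)}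
    (hb₀ : b₀ ∉ A₀) (S : Finset (Fin h)) :
    (starEntry (fun b e => if b = b₀ then (0 : ℂ[X]) else C (g b e)) (fun b e => if b = b₀ then (if e ∈ T then (X : ℂ[X]) else 0) else C (d b e)) (insert b₀ A₀) S).natDegree ≤ T.card := by
  classical
  rw [starEntry_insert_row_expand (fun b e => if b = b₀ then (0 : ℂ[X]) else C (g b e)) (fun b e => if b = b₀ then (if e ∈ T then (X : ℂ[X]) else 0) else C (d b e)) hb₀ (fun e _ => by simp)]
  refine natDegree_sum_le_of_forall_le _ _ fun A' hA' => natDegree_sum_le_of_forall_le _ _ fun S' _ => ?_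
  have hA'A : A' ⊆ A₀ := Finset.mem_powerset.mp hA'
  -- the first factor is a constant, the second is the one-vertex factor of the line
  have h1 : (∏ b ∈ A₀ \ A', ∑ e ∈ S', (fun b e => if b = b₀ then (0 : ℂ[X]) else C (g b e)) b e) = C (∏ b ∈ A₀ \ A', ∑ e ∈ S', g b e) := by
    rw [map_prod]
    refine Finset.prod_congr rfl fun b hb => ?_
    have hb' : b ≠ b₀ := by rintro rfl; exact hb₀ (Finset.mem_sdiff.mp hb).1
    rw [map_sum]
    exact Finset.sum_congr rfl fun e _ => by simp [hb']
  have h2 : (∏ e ∈ S \ S', ((fun b e => if b = b₀ then (if e ∈ T then (X : ℂ[X]) else 0) else C (d b e)) b₀ e + ∑ b ∈ A', (fun b e => if b = b₀ then (if e ∈ T then (X : ℂ[X]) else 0) else C (d b e)) b e)) =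
      ∏ e ∈ S \ S', ((if e ∈ T then (X : ℂ[X]) else 0) + C (∑ b ∈ A', d b e)) := by
    refine Finset.prod_congr rfl fun e _ => ?_
    have hsum : (∑ b ∈ A', (fun b e => if b = b₀ then (if e ∈ T then (X : ℂ[X]) else 0) else C (d b e)) b e) = C (∑ b ∈ A', d b e) := by
      rw [map_sum]
      refine Finset.sum_congr rfl fun b hb => ?_
      have hb' : b ≠ b₀ := by rintro rfl; exact hb₀ (hA'A hb)
      simp [hb']
    rw [hsum]; simp
  rw [h1, h2]
  exact (natDegree_C_mul_le _ _).trans (natDegree_prod_line_le T (S \ S') _)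

/-- **A row through `b₀` on the line: the top coefficient.** The `X^{|T|}`-coefficient of `starEntry (insert b₀ A₀) S` on the line is
`[T ⊆ S] · starEntry g d A₀ (S ∖ T)` — the top power forces `b₀` to be a centre whose leaf set is exactly `T`. -/
theorem coeff_starEntry_faceRow (g d : Fin h → Fin h → ℂ) (b₀ : Fin h) (T : Finset (Fin h)) {A₀ : Finset (Fin h)}
    (hb₀ : b₀ ∉ A₀) (S : Finset (Fin h)) :
    (starEntry (fun b e => if b = b₀ then (0 : ℂ[X]) else C (g b e)) (fun b e => if b = b₀ then (if e ∈ T then (X : ℂ[X]) else 0) else C (d b e)) (insert b₀ A₀) S).coeff T.card =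
      if T ⊆ S then starEntry g d A₀ (S \ T) else 0 := by
  classical
  rw [starEntry_insert_row_expand (fun b e => if b = b₀ then (0 : ℂ[X]) else C (g b e)) (fun b e => if b = b₀ then (if e ∈ T then (X : ℂ[X]) else 0) else C (d b e)) hb₀ (fun e _ => by simp)]
  -- each summand: constant × one-vertex factor
  have hterm : ∀ A' ∈ A₀.powerset, ∀ S' ∈ S.powerset,
      ((∏ b ∈ A₀ \ A', ∑ e ∈ S', (fun b e => if b = b₀ then (0 : ℂ[X]) else C (g b e)) b e) * ∏ e ∈ S \ S', ((fun b e => if b = b₀ then (if e ∈ T then (X : ℂ[X]) else 0) else C (d b e)) b₀ e + ∑ b ∈ A', (fun b e => if b = b₀ then (if e ∈ T then (X : ℂ[X]) else 0) else C (d b e)) b e)).coeff T.card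
        = (∏ b ∈ A₀ \ A', ∑ e ∈ S', g b e) * (if T ⊆ S \ S' then ∏ e ∈ (S \ S') \ T, ∑ b ∈ A', d b e else 0) := by
    intro A' hA' S' _
    have hA'A : A' ⊆ A₀ := Finset.mem_powerset.mp hA'
    have h1 : (∏ b ∈ A₀ \ A', ∑ e ∈ S', (fun b e => if b = b₀ then (0 : ℂ[X]) else C (g b e)) b e) = C (∏ b ∈ A₀ \ A', ∑ e ∈ S', g b e) := by
      rw [map_prod]
      refine Finset.prod_congr rfl fun b hb => ?_
      have hb' : b ≠ b₀ := by rintro rfl; exact hb₀ (Finset.mem_sdiff.mp hb).1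
      rw [map_sum]
      exact Finset.sum_congr rfl fun e _ => by simp [hb']
    have h2 : (∏ e ∈ S \ S', ((fun b e => if b = b₀ then (if e ∈ T then (X : ℂ[X]) else 0) else C (d b e)) b₀ e + ∑ b ∈ A', (fun b e => if b = b₀ then (if e ∈ T then (X : ℂ[X]) else 0) else C (d b e)) b e)) =
        ∏ e ∈ S \ S', ((if e ∈ T then (X : ℂ[X]) else 0) + C (∑ b ∈ A', d b e)) := by
      refine Finset.prod_congr rfl fun e _ => ?_
      have hsum : (∑ b ∈ A', (fun b e => if b = b₀ then (if e ∈ T then (X : ℂ[X]) else 0) else C (d b e)) b e) = C (∑ b ∈ A', d b e) := by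
        rw [map_sum]
        refine Finset.sum_congr rfl fun b hb => ?_
        have hb' : b ≠ b₀ := by rintro rfl; exact hb₀ (hA'A hb)
        simp [hb']
      rw [hsum]; simp
    rw [h1, h2, coeff_C_mul, coeff_prod_line]
  conv_lhs => rw [finsetSum_coeff]; arg 2; ext A'; rw [finsetSum_coeff]
  rw [Finset.sum_congr rfl fun A' hA' => Finset.sum_congr rfl fun S' hS' => hterm A' hA' S' hS']
  by_cases hTS : T ⊆ S
  · rw [if_pos hTS]
    unfold starEntry
    refine Finset.sum_congr rfl fun A' _ => ?_
    -- the inner sum over `S' ⊆ S` with `T ⊆ S ∖ S'` is the sum over `S' ⊆ S ∖ T`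
    rw [← Finset.sum_filter_of_ne (p := fun S' => T ⊆ S \ S') (fun S' _ hne => by
      by_contra hc; exact hne (by rw [if_neg hc, mul_zero]))]
    have hfilt : (S.powerset.filter fun S' => T ⊆ S \ S') = (S \ T).powerset := by
      ext S'
      simp only [Finset.mem_filter, Finset.mem_powerset]
      constructor
      · rintro ⟨hS'S, hT⟩ e he
        rw [Finset.mem_sdiff]
        exact ⟨hS'S he, fun heT => (Finset.mem_sdiff.mp (hT heT)).2 he⟩
      · intro hS'
        refine ⟨fun e he => (Finset.mem_sdiff.mp (hS' he)).1, fun e heT => ?_⟩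
        rw [Finset.mem_sdiff]
        exact ⟨hTS heT, fun heS' => (Finset.mem_sdiff.mp (hS' heS')).2 heT⟩
    rw [hfilt]
    refine Finset.sum_congr rfl fun S' hS' => ?_
    have hS'sub : S' ⊆ S \ T := Finset.mem_powerset.mp hS'
    have hT' : T ⊆ S \ S' := by
      intro e heT
      rw [Finset.mem_sdiff]
      exact ⟨hTS heT, fun heS' => (Finset.mem_sdiff.mp (hS'sub heS')).2 heT⟩
    rw [if_pos hT', sdiff_right_comm]
  · rw [if_neg hTS]
    refine Finset.sum_eq_zero fun A' _ => Finset.sum_eq_zero fun S' _ => ?_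
    rw [if_neg (fun hT' => hTS (fun e he => (Finset.mem_sdiff.mp (hT' he)).1)), mul_zero]

/-! ## 2. The face pivot -/

section FacePivot

variable {r : ℕ} (u w : Fin r → Finset (Fin h)) (b₀ : Fin h) (T : Finset (Fin h))

/-- **THE FACE PIVOT.** `u`, `w` any families of `r` row / column vertex sets, `b₀` a row vertex, `T` a set of column vertices, `σ` a
permutation of `Fin r` matching the columns containing `T` with the rows containing `b₀` (`T ⊆ w (σ j) ↔ b₀ ∈ u j`). If the LINK pair
(rows `(u i) − b₀`, columns `(w (σ j)) ∖ T`, over the indices with `b₀ ∈ u ·`) and the DELETION pair (rows `u i`, columns `w (σ j)`, over the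
indices with `b₀ ∉ u ·`) have nonsingular star-forest blocks, then `(u, w)` has a nonsingular star-forest block. (`T = {e₀}` is the balanced
vertex pivot of …StarPivot, here without lower-set hypotheses.) -/
theorem starDet_ne_zero_of_facePivot (σ : Equiv.Perm (Fin r))
    (hσ : ∀ j, T ⊆ w (σ j) ↔ b₀ ∈ u j)
    (Hlk : ∃ g d : Fin h → Fin h → ℂ,
      (Matrix.of fun i j : {i : Fin r // b₀ ∈ u i} => starEntry g d ((u i).erase b₀) ((w (σ j)) \ T)).det ≠ 0)
    (Hdl : ∃ g d : Fin h → Fin h → ℂ,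
      (Matrix.of fun i j : {i : Fin r // b₀ ∉ u i} => starEntry g d (u i) (w (σ j))).det ≠ 0) :
    ∃ g d : Fin h → Fin h → ℂ, (Matrix.of fun i j : Fin r => starEntry g d (u i) (w j)).det ≠ 0 := by
  classical
  obtain ⟨g, d, hlk, hdl⟩ := exists_common_point _ _ _ _ Hlk Hdl
  -- the star matrix on the line, and the same with the constant rows scaled by `X^{|T|}`
  let MP : Matrix (Fin r) (Fin r) ℂ[X] := Matrix.of fun i j => starEntry (fun b e => if b = b₀ then (0 : ℂ[X]) else C (g b e)) (fun b e => if b = b₀ then (if e ∈ T then (X : ℂ[X]) else 0) else C (d b e)) (u i) (w j)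
  let v : Fin r → ℂ[X] := fun i => if b₀ ∈ u i then 1 else X ^ T.card
  let MS : Matrix (Fin r) (Fin r) ℂ[X] := Matrix.of fun i j => v i * MP i j
  -- entries of `MS`: degree ≤ |T| and top coefficients
  have hrow_in : ∀ i, b₀ ∈ u i → u i = insert b₀ ((u i).erase b₀) := fun i hi => (Finset.insert_erase hi).symm
  have hdeg : ∀ i j, (MS i j).natDegree ≤ T.card := by
    intro i j
    simp only [MS, MP, v, Matrix.of_apply]
    by_cases hi : b₀ ∈ u i
    · rw [if_pos hi, one_mul, hrow_in i hi]
      exact natDegree_starEntry_faceRow_le g d b₀ T (Finset.notMem_erase b₀ (u i)) (w j)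
    · rw [if_neg hi, starEntry_fp_of_notMem g d b₀ T hi, mul_comm]
      exact natDegree_C_mul_X_pow_le _ _
  let N : Matrix (Fin r) (Fin r) ℂ := Matrix.of fun i j =>
    if b₀ ∈ u i then (if T ⊆ w j then starEntry g d ((u i).erase b₀) (w j \ T) else 0) else starEntry g d (u i) (w j)
  have hcoefN : (MS.map fun p => p.coeff T.card) = N := by
    ext i j
    simp only [MS, MP, v, N, Matrix.map_apply, Matrix.of_apply]
    by_cases hi : b₀ ∈ u i
    · rw [if_pos hi, if_pos hi, one_mul]
      conv_lhs => rw [hrow_in i hi]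
      exact coeff_starEntry_faceRow g d b₀ T (Finset.notMem_erase b₀ (u i)) (w j)
    · rw [if_neg hi, if_neg hi, starEntry_fp_of_notMem g d b₀ T hi, mul_comm, coeff_C_mul_X_pow]
      simp
  -- `N` is block triangular after permuting the columns by `σ`
  let N₃ : Matrix (Fin r) (Fin r) ℂ := N.submatrix id σ
  have hN₃ : ∀ i j, N₃ i j = if b₀ ∈ u i then (if b₀ ∈ u j then starEntry g d ((u i).erase b₀) (w (σ j) \ T) else 0)
      else starEntry g d (u i) (w (σ j)) := by
    intro i j
    show N i (σ j) = _
    simp only [N, Matrix.of_apply]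
    by_cases hi : b₀ ∈ u i
    · rw [if_pos hi, if_pos hi]
      by_cases hj : b₀ ∈ u j
      · rw [if_pos ((hσ j).mpr hj), if_pos hj]
      · rw [if_neg (fun h' => hj ((hσ j).mp h')), if_neg hj]
    · rw [if_neg hi, if_neg hi]
  have hdet₃ : N₃.det = (Matrix.toSquareBlockProp N₃ (fun i => b₀ ∈ u i)).det *
      (Matrix.toSquareBlockProp N₃ (fun i => ¬ b₀ ∈ u i)).det := by
    apply Matrix.twoBlockTriangular_det'
    intro i hi j hj
    rw [hN₃ i j, if_pos hi, if_neg hj]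
  have hblk₁ : Matrix.toSquareBlockProp N₃ (fun i => b₀ ∈ u i) =
      Matrix.of fun i j : {i : Fin r // b₀ ∈ u i} => starEntry g d ((u i).erase b₀) ((w (σ j)) \ T) := by
    rw [Matrix.toSquareBlockProp_def]
    ext i j
    simp only [Matrix.of_apply]
    rw [hN₃ i j, if_pos i.2, if_pos j.2]
  have hblk₂ : Matrix.toSquareBlockProp N₃ (fun i => ¬ b₀ ∈ u i) =
      Matrix.of fun i j : {i : Fin r // b₀ ∉ u i} => starEntry g d (u i) (w (σ j)) := by
    rw [Matrix.toSquareBlockProp_def]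
    ext i j
    simp only [Matrix.of_apply]
    rw [hN₃ i j, if_neg i.2]
  have hdet₃ne : N₃.det ≠ 0 := by
    rw [hdet₃, hblk₁, hblk₂]
    exact mul_ne_zero hlk hdl
  have hdetN : N.det ≠ 0 := by
    intro h0
    apply hdet₃ne
    show (N.submatrix id σ).det = 0
    rw [Matrix.det_permute', h0, mul_zero]
  -- hence the top coefficient of `det MS` is nonzero, so `det MS ≠ 0` and `det MP ≠ 0`
  have hcoef : (MS.det).coeff (Fintype.card (Fin r) * T.card) = N.det := by
    rw [Literature.AlgebraicGeometry.DeterminantalHypersurfaces.coeff_det_of_natDegree_le MS T.card hdeg, hcoefN]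
  have hMS : MS.det ≠ 0 := by
    intro h0
    apply hdetN
    rw [← hcoef, h0, coeff_zero]
  have hMSeq : MS = Matrix.diagonal v * MP := by
    ext i j
    simp only [MS, Matrix.of_apply, Matrix.diagonal_mul]
  have hMP : MP.det ≠ 0 := by
    intro h0
    apply hMS
    rw [hMSeq, Matrix.det_mul, h0, mul_zero]
  -- a nonzero complex polynomial has a non-root
  have hex : ∃ t : ℂ, ¬ (MP.det).IsRoot t := by
    by_contra hall
    push Not at hall
    apply hMP
    apply Polynomial.eq_zero_of_infinite_isRoot
    have huniv : {x : ℂ | (MP.det).IsRoot x} = Set.univ := Set.eq_univ_of_forall fun x => hall x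
    rw [huniv]
    exact Set.infinite_univ
  obtain ⟨t, ht⟩ := hex
  refine ⟨fun b e => Polynomial.eval t ((fun b e => if b = b₀ then (0 : ℂ[X]) else C (g b e)) b e), fun b e => Polynomial.eval t ((fun b e => if b = b₀ then (if e ∈ T then (X : ℂ[X]) else 0) else C (d b e)) b e), ?_⟩
  have hev : Polynomial.eval t MP.det =
      (Matrix.of fun i j : Fin r => starEntry (fun b e => Polynomial.eval t ((fun b e => if b = b₀ then (0 : ℂ[X]) else C (g b e)) b e))
        (fun b e => Polynomial.eval t ((fun b e => if b = b₀ then (if e ∈ T then (X : ℂ[X]) else 0) else C (d b e)) b e)) (u i) (w j)).det := by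
    rw [← Polynomial.coe_evalRingHom, RingHom.map_det, RingHom.mapMatrix_apply]
    congr 1; ext i j; simp only [MP, Matrix.map_apply, Matrix.of_apply]; rw [map_starEntry]
  rw [← hev]
  exact ht

/-- **THE FACE PIVOT, swapped orientation:** a column vertex `e₀` against a set `A₀` of row vertices, `σ` matching the rows containing `A₀`
with the columns containing `e₀` (`A₀ ⊆ u (σ i) ↔ e₀ ∈ w i`); LINK pair (rows `(u (σ i)) ∖ A₀`, columns `(w j) − e₀`, over `e₀ ∈ w ·`) and
DELETION pair (rows `u (σ i)`, columns `w j`, over `e₀ ∉ w ·`). -/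
theorem starDet_ne_zero_of_facePivot_swap (e₀ : Fin h) (A₀ : Finset (Fin h)) (σ : Equiv.Perm (Fin r))
    (hσ : ∀ i, A₀ ⊆ u (σ i) ↔ e₀ ∈ w i)
    (Hlk : ∃ g d : Fin h → Fin h → ℂ,
      (Matrix.of fun i j : {j : Fin r // e₀ ∈ w j} => starEntry g d ((u (σ i)) \ A₀) ((w j).erase e₀)).det ≠ 0)
    (Hdl : ∃ g d : Fin h → Fin h → ℂ,
      (Matrix.of fun i j : {j : Fin r // e₀ ∉ w j} => starEntry g d (u (σ i)) (w j)).det ≠ 0) :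
    ∃ g d : Fin h → Fin h → ℂ, (Matrix.of fun i j : Fin r => starEntry g d (u i) (w j)).det ≠ 0 := by
  classical
  -- transport both hypotheses to the swapped pair `(w, u)`
  have Hlk' : ∃ g d : Fin h → Fin h → ℂ,
      (Matrix.of fun i j : {j : Fin r // e₀ ∈ w j} => starEntry g d ((w i).erase e₀) ((u (σ j)) \ A₀)).det ≠ 0 := by
    obtain ⟨g, d, hd⟩ := Hlk
    refine ⟨fun e b => d b e, fun e b => g b e, ?_⟩
    have hmat : (Matrix.of fun i j : {j : Fin r // e₀ ∈ w j} => starEntry (fun e b => d b e) (fun e b => g b e) ((w i).erase e₀) ((u (σ j)) \ A₀))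
        = (Matrix.of fun i j : {j : Fin r // e₀ ∈ w j} => starEntry g d ((u (σ i)) \ A₀) ((w j).erase e₀)).transpose := by
      ext i j
      simp only [Matrix.of_apply, Matrix.transpose_apply]
      rw [← starEntry_swap]
    rw [hmat, Matrix.det_transpose]
    exact hd
  have Hdl' : ∃ g d : Fin h → Fin h → ℂ,
      (Matrix.of fun i j : {j : Fin r // e₀ ∉ w j} => starEntry g d (w i) (u (σ j))).det ≠ 0 := by
    obtain ⟨g, d, hd⟩ := Hdl
    refine ⟨fun e b => d b e, fun e b => g b e, ?_⟩
    have hmat : (Matrix.of fun i j : {j : Fin r // e₀ ∉ w j} => starEntry (fun e b => d b e) (fun e b => g b e) (w i) (u (σ j)))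
        = (Matrix.of fun i j : {j : Fin r // e₀ ∉ w j} => starEntry g d (u (σ i)) (w j)).transpose := by
      ext i j
      simp only [Matrix.of_apply, Matrix.transpose_apply]
      rw [← starEntry_swap]
    rw [hmat, Matrix.det_transpose]
    exact hd
  obtain ⟨g', d', hdet⟩ := starDet_ne_zero_of_facePivot w u e₀ A₀ σ hσ Hlk' Hdl'
  refine ⟨fun b e => d' e b, fun b e => g' e b, ?_⟩
  have hmat : (Matrix.of fun i j : Fin r => starEntry (fun b e => d' e b) (fun b e => g' e b) (u i) (w j))
      = (Matrix.of fun i j : Fin r => starEntry g' d' (w i) (u j)).transpose := by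
    ext i j
    simp only [Matrix.of_apply, Matrix.transpose_apply]
    rw [starEntry_swap]
  rw [hmat, Matrix.det_transpose]
  exact hdet

end FacePivot

end StarDoor

end

end Summit.ValiantsHypothesis.ValiantsHypothesis.Theorems.BarrierLever.AnchoredPeeling
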